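import Summits.QuantumAdvantage.AdviceFreeQNC0.WalkFailSetHitsSharp
import Summits.QuantumAdvantage.AdviceFreeQNC0.TensorBlocks
import Mathlib.Analysis.SpecificLimits.Normed
import HarnessLib

/-!
# Cell qa-qnc0 (rung F-Q1, route RingFrame, crux α `RingToElim`, density axis): the SHARP
# interpolation bound in `T10W` shape — `RingFailLinearWalk c` for every `c > 13 − 5·log₂ 5 ≈ 1.3904`

`WalkFailSetHitsSharp.lean` (prover qn-prover-3 gen 6) proves, for every walk strategy of degree
`≤ D` on `ℓ ≥ m ≥ 2D + 3D' + 3` bits and every charge, `#FAIL ≥ 2^{ℓ−m}·N_{D'}(m)` with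
`N_{D'}(m) = Σ_{j ≤ D'} C(m, j)` (`card_ringWinU_le_failSetHits_sharp`); numerically the deficit
`m − log₂ N_{D'}(m)` is `≈ 1.388·D` at the best `(m, D')`, but the kernel had this exponent only as the
value of a binomial sum.  The planners' density-axis currency is the `T10W`-shaped statement
`RingFailLinearWalk c` (`TensorBlocks.lean`: `∃ λ D₀, ∀ D ≥ D₀, ∀ n ≥ λD`, every degree-`D` walk
strategy wins on `≤ (1 − 2^{−cD})·2ⁿ` inputs; `T10W` asks for some `c < 1`), known so far for every
`c > log₂ 3 ≈ 1.585` (`ringFailLinearWalk_of_logb_lt`, degree-0 tensor floor).  This file supplies the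
missing ENTROPY LOWER BOUND for binomial coefficients and closes the bookkeeping:

* `pow_le_choose_mul` — **the largest term of the binomial expansion**:
  `m^m ≤ (m+1) · k^k (m−k)^{m−k} C(m,k)` for `k ≤ m` (`m^m = (k + (m−k))^m = Σ_j C(m,j) k^j (m−k)^{m−j}`
  and the `j = k` term is the largest: the term ratio `t_{j+1}/t_j = (m−j)k / ((j+1)(m−k))` is `≥ 1`
  iff `j < k`).  This is `C(m,k) ≥ 2^{m·H(k/m)}/(m+1)` in integer form. [folklore]
* `choose_five_mul` — the instance `m = 5k`: `3125^k ≤ (5k+1) · C(5k,k) · 256^k`, i.e.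
  `C(5k,k)/2^{5k} ≥ (3125/8192)^k/(5k+1)`.
* **`ringFailLinearWalk_of_entropy_lt : ∀ c > log₂(8192/3125), RingFailLinearWalk c`** — with
  `D' = D + 2`, `m = 5(D+2)` (so `2D + 3D' + 3 ≤ m`), `λ = 15`:
  `#FAIL/2ⁿ ≥ C(5(D+2), D+2)/2^{5(D+2)} ≥ 2^{−c₀(D+2)}/(5D+11) ≥ 2^{−cD}` for `D ≥ D₀(c)`, where
  `c₀ = log₂(8192/3125) = 13 − 5 log₂ 5 ≈ 1.39036` (the ratio `k/m = 1/5` is within `0.002·D` bits of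
  the optimum `≈ 1.3886·D` of the interpolation method and keeps the arithmetic in `ℕ`).

So the density-axis kernel exponent in `T10W` shape moves from `log₂ 3 + ε` to `1.3904 + ε`.
WHAT THIS IS NOT: still `> 1` — `T10W` (`c < 1`) is untouched, and the interpolation method cannot
cross `1` (gen-6 memo: the `3D'` is intrinsic at `D = 0`); nothing on α at constant `η`; separation
NOT moved.  The cell's bookkeeping (prover qn-prover-3 gen 7, 2026-08-27); the binomial bound is
folklore (e.g. Cover–Thomas, *Elements of Information Theory*, Lemma 17.5.1 / eq. (11.40)).
-/

noncomputable section

namespace Summit.QuantumAdvantage.AdviceFreeQNC0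

open Finset Filter
open Literature.Computability.MetaComplexity Literature.Computability.MetaComplexity.Smolensky

/-! ### The largest term of the binomial expansion of `m^m = (k + (m − k))^m` -/

/-! Below, the `j`-th term of the expansion of `(k + (m−k))^m` is written out as
`k ^ j * (m - k) ^ (m - j) * m.choose j` (no auxiliary definition). -/

/-- The term ratio, cross-multiplied: `t_{j+1} · (j+1)(m−k) = t_j · (m−j)k` (`j < m`). [folklore] -/
private theorem bterm_succ_mul {m k j : ℕ} (hj : j < m) :
    (k ^ (j + 1) * (m - k) ^ (m - (j + 1)) * m.choose (j + 1)) * ((j + 1) * (m - k)) =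
      (k ^ j * (m - k) ^ (m - j) * m.choose j) * ((m - j) * k) := by
  have hc : m.choose (j + 1) * (j + 1) = m.choose j * (m - j) := Nat.choose_succ_right_eq m j
  have hp : (m - k) ^ (m - (j + 1)) * (m - k) = (m - k) ^ (m - j) := by
    rw [← pow_succ]
    congr 1
    omega
  calc k ^ (j + 1) * (m - k) ^ (m - (j + 1)) * m.choose (j + 1) * ((j + 1) * (m - k))
      = k ^ j * k * ((m - k) ^ (m - (j + 1)) * (m - k)) * (m.choose (j + 1) * (j + 1)) := by ring
    _ = k ^ j * k * (m - k) ^ (m - j) * (m.choose j * (m - j)) := by rw [hp, hc]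
    _ = k ^ j * (m - k) ^ (m - j) * m.choose j * ((m - j) * k) := by ring

/-- Increasing up to `k`: `t_j ≤ t_{j+1}` for `j + 1 ≤ k ≤ m`. [folklore] -/
private theorem bterm_le_succ {m k j : ℕ} (hjk : j + 1 ≤ k) (hkm : k ≤ m) :
    (k ^ j * (m - k) ^ (m - j) * m.choose j) ≤
      (k ^ (j + 1) * (m - k) ^ (m - (j + 1)) * m.choose (j + 1)) := by
  by_cases hmk : m - k = 0
  · -- `m = k`: the `j`-th term vanishes (`j < m`)
    have : (k ^ j * (m - k) ^ (m - j) * m.choose j) = 0 := by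
      rw [hmk, zero_pow (by omega), mul_zero, zero_mul]
    rw [this]
    exact Nat.zero_le _
  · have hpos : 0 < (j + 1) * (m - k) := Nat.mul_pos (by omega) (by omega)
    refine Nat.le_of_mul_le_mul_right ?_ hpos
    rw [bterm_succ_mul (by omega)]
    refine Nat.mul_le_mul_left _ ?_
    -- `(j+1)(m−k) ≤ (m−j)k`
    obtain ⟨d, rfl⟩ : ∃ d, k = j + 1 + d := ⟨k - (j + 1), by omega⟩
    obtain ⟨a, rfl⟩ : ∃ a, m = j + 1 + d + a := ⟨m - (j + 1 + d), by omega⟩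
    have e1 : j + 1 + d + a - (j + 1 + d) = a := by omega
    have e2 : j + 1 + d + a - j = 1 + d + a := by omega
    rw [e1, e2]
    nlinarith

/-- Decreasing after `k`: `t_{j+1} ≤ t_j` for `k ≤ j < m`. [folklore] -/
private theorem bterm_succ_le {m k j : ℕ} (hkj : k ≤ j) (hjm : j < m) :
    (k ^ (j + 1) * (m - k) ^ (m - (j + 1)) * m.choose (j + 1)) ≤
      (k ^ j * (m - k) ^ (m - j) * m.choose j) := by
  by_cases hk : k = 0
  · have : (k ^ (j + 1) * (m - k) ^ (m - (j + 1)) * m.choose (j + 1)) = 0 := by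
      rw [hk, zero_pow (by omega), zero_mul, zero_mul]
    rw [this]
    exact Nat.zero_le _
  · have hpos : 0 < (j + 1) * (m - k) := Nat.mul_pos (by omega) (by omega)
    refine Nat.le_of_mul_le_mul_right ?_ hpos
    rw [bterm_succ_mul hjm]
    refine Nat.mul_le_mul_left _ ?_
    -- `(m−j)k ≤ (j+1)(m−k)`
    obtain ⟨d, rfl⟩ : ∃ d, j = k + d := ⟨j - k, by omega⟩
    obtain ⟨e, rfl⟩ : ∃ e, m = k + d + 1 + e := ⟨m - (k + d + 1), by omega⟩
    have e1 : k + d + 1 + e - (k + d) = 1 + e := by omega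
    have e2 : k + d + 1 + e - k = d + 1 + e := by omega
    rw [e1, e2]
    nlinarith

/-- Every term is at most the `k`-th one (`j, k ≤ m`). [folklore] -/
private theorem bterm_le_bterm {m k : ℕ} (hkm : k ≤ m) {j : ℕ} (hjm : j ≤ m) :
    (k ^ j * (m - k) ^ (m - j) * m.choose j) ≤ (k ^ k * (m - k) ^ (m - k) * m.choose k) := by
  rcases le_or_gt j k with hjk | hkj
  · -- climb from `j` to `k`
    have key : ∀ d i : ℕ, i + d = k →
        (k ^ i * (m - k) ^ (m - i) * m.choose i) ≤ (k ^ k * (m - k) ^ (m - k) * m.choose k) := by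
      intro d
      induction d with
      | zero => intro i hi; rw [Nat.add_zero] at hi; rw [hi]
      | succ d ih =>
        intro i hi
        exact (bterm_le_succ (by omega) hkm).trans (ih (i + 1) (by omega))
    exact key (k - j) j (by omega)
  · -- descend from `j` to `k`
    have key : ∀ d i : ℕ, i = k + d → i ≤ m →
        (k ^ i * (m - k) ^ (m - i) * m.choose i) ≤ (k ^ k * (m - k) ^ (m - k) * m.choose k) := by
      intro d
      induction d with
      | zero => intro i hi _; rw [hi, Nat.add_zero]
      | succ d ih =>
        intro i hi him
        rw [hi, ← Nat.add_assoc]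
        exact (bterm_succ_le (by omega) (by omega)).trans (ih (k + d) rfl (by omega))
    exact key (j - k) j (by omega) hjm

/-- **The largest term of the binomial expansion** (the entropy lower bound for binomial
coefficients in integer form, `C(m,k) ≥ 2^{m H(k/m)}/(m+1)`): for `k ≤ m`,
`m^m ≤ (m+1) · (k^k · (m−k)^{m−k} · C(m,k))`. [folklore] -/
theorem pow_le_choose_mul {m k : ℕ} (hkm : k ≤ m) :
    m ^ m ≤ (m + 1) * (k ^ k * (m - k) ^ (m - k) * m.choose k) := by
  have hexp : m ^ m = ∑ j ∈ range (m + 1), (k ^ j * (m - k) ^ (m - j) * m.choose j) := by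
    have h := add_pow k (m - k) m
    rwa [Nat.add_sub_cancel' hkm] at h
  rw [hexp]
  have hb : ∀ j ∈ range (m + 1),
      (k ^ j * (m - k) ^ (m - j) * m.choose j) ≤ (k ^ k * (m - k) ^ (m - k) * m.choose k) :=
    fun j hj => bterm_le_bterm hkm (by have := mem_range.1 hj; omega)
  refine (Finset.sum_le_card_nsmul _ _ _ hb).trans ?_
  rw [card_range, smul_eq_mul]

/-- The instance `m = 5k`: **`3125^k ≤ (5k+1) · C(5k,k) · 256^k`**, i.e.
`C(5k,k)/2^{5k} ≥ (3125/8192)^k/(5k+1)` (`3125 = 5⁵`, `256 = 4⁴`, `8192 = 2¹³`). [folklore] -/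
theorem choose_five_mul (k : ℕ) : 3125 ^ k ≤ (5 * k + 1) * (5 * k).choose k * 256 ^ k := by
  rcases Nat.eq_zero_or_pos k with rfl | hk
  · simp
  have h := pow_le_choose_mul (show k ≤ 5 * k by omega)
  rw [show 5 * k - k = 4 * k by omega] at h
  have e1 : (5 * k) ^ (5 * k) = 3125 ^ k * k ^ (5 * k) := by
    rw [mul_pow, pow_mul]; norm_num
  have e2 : k ^ k * (4 * k) ^ (4 * k) = 256 ^ k * k ^ (5 * k) := by
    rw [mul_pow, pow_mul]
    have : k ^ k * k ^ (4 * k) = k ^ (5 * k) := by rw [← pow_add]; congr 1; ring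
    calc k ^ k * ((4 ^ 4) ^ k * k ^ (4 * k)) = (4 ^ 4) ^ k * (k ^ k * k ^ (4 * k)) := by ring
      _ = 256 ^ k * k ^ (5 * k) := by rw [this]; norm_num
  rw [e1, e2] at h
  have hkpos : 0 < k ^ (5 * k) := pow_pos hk _
  refine Nat.le_of_mul_le_mul_right ?_ hkpos
  calc 3125 ^ k * k ^ (5 * k) ≤ (5 * k + 1) * (256 ^ k * k ^ (5 * k) * (5 * k).choose k) := h
    _ = (5 * k + 1) * (5 * k).choose k * 256 ^ k * k ^ (5 * k) := by ring

/-! ### The exponent bookkeeping -/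

/-- A single binomial coefficient is at most `N_{D'}(m)`. -/
private theorem choose_le_numMonomials (m D' : ℕ) : m.choose D' ≤ numMonomials m D' := by
  unfold numMonomials
  exact Finset.single_le_sum (f := fun j => m.choose j) (fun _ _ => Nat.zero_le _)
    (mem_range.2 (Nat.lt_succ_self D'))

/-- The real-number form of `choose_five_mul`: `(3125/8192)^k/(5k+1) ≤ C(5k,k)/2^{5k}`. -/
private theorem choose_five_mul_real (k : ℕ) :
    (3125 / 8192 : ℝ) ^ k / (5 * (k : ℝ) + 1) ≤ ((5 * k).choose k : ℝ) / (2 : ℝ) ^ (5 * k) := by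
  have h : (3125 : ℝ) ^ k ≤ (5 * (k : ℝ) + 1) * ((5 * k).choose k : ℝ) * 256 ^ k := by
    exact_mod_cast choose_five_mul k
  have hk : (0 : ℝ) < 5 * (k : ℝ) + 1 := by positivity
  have h32 : (2 : ℝ) ^ (5 * k) = 32 ^ k := by rw [pow_mul]; norm_num
  rw [h32, div_le_div_iff₀ hk (by positivity), div_pow,
    show (8192 : ℝ) ^ k = 256 ^ k * 32 ^ k by rw [← mul_pow]; norm_num]
  rw [div_mul_eq_mul_div, div_le_iff₀ (by positivity)]
  calc (3125 : ℝ) ^ k * 32 ^ k ≤ (5 * (k : ℝ) + 1) * ((5 * k).choose k : ℝ) * 256 ^ k * 32 ^ k :=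
        mul_le_mul_of_nonneg_right h (by positivity)
    _ = ((5 * k).choose k : ℝ) * (5 * (k : ℝ) + 1) * (256 ^ k * 32 ^ k) := by ring

/-- The growth step: once `16 · 2^{2c₀} · D · 2^{−(c−c₀)D} ≤ 1` and `D ≥ 1`,
`2^{−cD} · (5D + 11) ≤ 2^{−c₀(D+2)}`. -/
private theorem rpow_step {c c₀ : ℝ} {D : ℕ} (hD1 : 1 ≤ D)
    (h : 16 * (2 : ℝ) ^ (2 * c₀) * (D : ℝ) * (2 : ℝ) ^ (-((c - c₀) * (D : ℝ))) ≤ 1) :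
    (2 : ℝ) ^ (-(c * (D : ℝ))) * (5 * (D : ℝ) + 11) ≤ (2 : ℝ) ^ (-(c₀ * ((D : ℝ) + 2))) := by
  have h2 : (0 : ℝ) < 2 := by norm_num
  set A : ℝ := (2 : ℝ) ^ (-(c * (D : ℝ))) with hA
  set B : ℝ := (2 : ℝ) ^ ((c - c₀) * (D : ℝ)) with hB
  set C₀ : ℝ := (2 : ℝ) ^ (2 * c₀) with hC₀
  have hApos : 0 < A := Real.rpow_pos_of_pos h2 _
  have hBpos : 0 < B := Real.rpow_pos_of_pos h2 _
  have hCpos : 0 < C₀ := Real.rpow_pos_of_pos h2 _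
  have hinv : (2 : ℝ) ^ (-((c - c₀) * (D : ℝ))) = B⁻¹ := by
    rw [hB, Real.rpow_neg h2.le]
  have htarget : (2 : ℝ) ^ (-(c₀ * ((D : ℝ) + 2))) = A * B * C₀⁻¹ := by
    rw [hA, hB, hC₀, ← Real.rpow_neg h2.le, ← Real.rpow_add h2, ← Real.rpow_add h2]
    congr 1
    ring
  rw [htarget]
  rw [hinv] at h
  -- `16 C₀ D ≤ B`
  have h16 : 16 * C₀ * (D : ℝ) ≤ B := by
    have := mul_le_mul_of_nonneg_right h hBpos.le
    rwa [one_mul, mul_assoc (16 * C₀ * (D : ℝ)), inv_mul_cancel₀ hBpos.ne', mul_one] at this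
  have hD : (1 : ℝ) ≤ (D : ℝ) := by exact_mod_cast hD1
  have h5 : 5 * (D : ℝ) + 11 ≤ 16 * (D : ℝ) := by linarith
  have h6 : 16 * (D : ℝ) ≤ B * C₀⁻¹ := by
    rw [← div_eq_mul_inv, le_div_iff₀ hCpos]
    linarith
  calc A * (5 * (D : ℝ) + 11) ≤ A * (16 * (D : ℝ)) := mul_le_mul_of_nonneg_left h5 hApos.le
    _ ≤ A * (B * C₀⁻¹) := mul_le_mul_of_nonneg_left h6 hApos.le
    _ = A * B * C₀⁻¹ := by ring

/-! ### `RingFailLinearWalk c` for every `c > log₂(8192/3125) ≈ 1.3904` -/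

/-- **The sharp interpolation bound in `T10W` shape**: `RingFailLinearWalk c` for every
`c > c₀ := log₂(8192/3125) = 13 − 5·log₂ 5 ≈ 1.39036` — for `D ≥ D₀(c)` and `n ≥ 15·D`, every walk
strategy of degree `≤ D` (every charge) wins on at most `(1 − 2^{−cD})·2ⁿ` inputs.  Improves the
kernel's `T10W`-shaped exponent from `log₂ 3 + ε` (`ringFailLinearWalk_of_logb_lt`) to
`1.3904 + ε`; `T10W` itself asks for `c < 1`. -/
theorem ringFailLinearWalk_of_entropy_lt {c : ℝ} (hc : Real.logb 2 (8192 / 3125) < c) :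
    RingFailLinearWalk c := by
  have h2 : (0 : ℝ) < 2 := by norm_num
  set c₀ : ℝ := Real.logb 2 (8192 / 3125) with hc₀def
  have hc₀ : (2 : ℝ) ^ (-c₀) = 3125 / 8192 := by
    rw [Real.rpow_neg h2.le, hc₀def, Real.rpow_logb (by norm_num) (by norm_num) (by norm_num)]
    norm_num
  -- the slack `ε = c − c₀ > 0` and the ratio `r = 2^{−ε} ∈ (0, 1)`
  have hε : 0 < c - c₀ := by linarith
  set r : ℝ := (2 : ℝ) ^ (-(c - c₀)) with hr
  have hr0 : 0 < r := Real.rpow_pos_of_pos h2 _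
  have hr1 : r < 1 := by
    rw [hr]
    exact Real.rpow_lt_one_of_one_lt_of_neg (by norm_num) (by linarith)
  -- `D · r^D → 0`: beyond some `D₁` it is below `η = 1/(16 · 2^{2c₀})`
  set η : ℝ := 1 / (16 * (2 : ℝ) ^ (2 * c₀)) with hη
  have hC : (0 : ℝ) < (2 : ℝ) ^ (2 * c₀) := Real.rpow_pos_of_pos h2 _
  have hηpos : 0 < η := by rw [hη]; positivity
  have ht := tendsto_self_mul_const_pow_of_lt_one hr0.le hr1
  obtain ⟨D₁, hD₁⟩ := eventually_atTop.1 ((tendsto_order.1 ht).2 η hηpos)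
  refine ⟨15, max 1 D₁, fun D hD n hn ch y hy => ?_⟩
  have hD1 : 1 ≤ D := le_trans (le_max_left _ _) hD
  have hDD₁ : D₁ ≤ D := le_trans (le_max_right _ _) hD
  -- the sharp fail-set bound with `D' = D + 2`, block length `m = 5(D+2) ≤ n`
  have hm : 2 * D + 3 * (D + 2) + 3 ≤ 5 * (D + 2) := by omega
  have hℓ : 5 * (D + 2) ≤ n := by
    have : 5 * (D + 2) ≤ 15 * D := by omega
    exact le_trans this hn
  have hwin := card_ringWinU_le_failSetHits_sharp D (D + 2) hm hℓ ch y hy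
  -- `2^{−cD} ≤ C(5(D+2), D+2)/2^{5(D+2)} ≤ N_{D+2}(5(D+2))/2^{5(D+2)}`
  have hgrowth : (D : ℝ) * r ^ D < η := hD₁ D hDD₁
  have hstep :
      (2 : ℝ) ^ (-(c * (D : ℝ))) * (5 * (D : ℝ) + 11) ≤ (2 : ℝ) ^ (-(c₀ * ((D : ℝ) + 2))) := by
    refine rpow_step hD1 ?_
    have hrD : r ^ D = (2 : ℝ) ^ (-((c - c₀) * (D : ℝ))) := by
      rw [hr, ← Real.rpow_natCast, ← Real.rpow_mul h2.le]
      congr 1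
      ring
    rw [← hrD]
    have := mul_le_mul_of_nonneg_left hgrowth.le
      (show (0 : ℝ) ≤ 16 * (2 : ℝ) ^ (2 * c₀) by positivity)
    rw [hη, mul_one_div, div_self (by positivity)] at this
    calc 16 * (2 : ℝ) ^ (2 * c₀) * (D : ℝ) * r ^ D
        = 16 * (2 : ℝ) ^ (2 * c₀) * ((D : ℝ) * r ^ D) := by ring
      _ ≤ 1 := this
  have hpow : (2 : ℝ) ^ (-(c₀ * ((D : ℝ) + 2))) = (3125 / 8192 : ℝ) ^ (D + 2) := by
    rw [← hc₀, ← Real.rpow_natCast, ← Real.rpow_mul h2.le]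
    congr 1
    push_cast
    ring
  have hk : (0 : ℝ) < 5 * (D : ℝ) + 11 := by positivity
  have hexp : (2 : ℝ) ^ (-(c * (D : ℝ))) ≤
      (numMonomials (5 * (D + 2)) (D + 2) : ℝ) / (2 : ℝ) ^ (5 * (D + 2)) := by
    have h1 : (2 : ℝ) ^ (-(c * (D : ℝ))) ≤
        (3125 / 8192 : ℝ) ^ (D + 2) / (5 * ((D + 2 : ℕ) : ℝ) + 1) := by
      rw [le_div_iff₀ (by positivity), ← hpow]
      push_cast
      calc (2 : ℝ) ^ (-(c * (D : ℝ))) * (5 * ((D : ℝ) + 2) + 1)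
          = (2 : ℝ) ^ (-(c * (D : ℝ))) * (5 * (D : ℝ) + 11) := by ring
        _ ≤ (2 : ℝ) ^ (-(c₀ * ((D : ℝ) + 2))) := hstep
    have h2' := choose_five_mul_real (D + 2)
    have h3 : (((5 * (D + 2)).choose (D + 2) : ℕ) : ℝ) ≤
        (numMonomials (5 * (D + 2)) (D + 2) : ℝ) := by
      exact_mod_cast choose_le_numMonomials (5 * (D + 2)) (D + 2)
    exact h1.trans (h2'.trans (div_le_div_of_nonneg_right h3 (by positivity)))
  have h2n : (0 : ℝ) ≤ (2 : ℝ) ^ n := by positivity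
  calc ((univ.filter fun u : Fin n → Bool => ringWinU ch y u = true).card : ℝ)
      ≤ (1 - (numMonomials (5 * (D + 2)) (D + 2) : ℝ) / (2 : ℝ) ^ (5 * (D + 2))) * (2 : ℝ) ^ n :=
        hwin
    _ ≤ (1 - (2 : ℝ) ^ (-(c * (D : ℝ)))) * (2 : ℝ) ^ n :=
        mul_le_mul_of_nonneg_right (by linarith) h2n

end Summit.QuantumAdvantage.AdviceFreeQNC0

end
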